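import Summits.Ventures.PercRepro.C041RcPortRecolour

/-!
# THEOREM R, the rc reduction without an edge between the terminals: the red bridge and the general validity
dictionary (p6, gen 24; mine-3, C-041.md §3 «red type D ⟺ (X₁ ∨ X₂) ∧ (X₁X₂ ∨ Y)» and REMARK (4))

Setting of `C041RcPortRecolour`.  `RedBridge O S` (mine-3's `Y`, with the red edges between the terminals folded
in): some edge between `a` and `b` is red, or some vertex `u` outside `K` carries a red edge to `a` and is
red-bare-connected to a vertex carrying a red edge to `b` — a condition on the NON-PORT edges only
(`redBridge_rcRecolour`).  **`rc_valid_iff`**: `c ~_red a ∧ c ~_red b ↔ (X₁ ∨ X₂) ∧ (X₁ ∧ X₂ ∨ RedBridge O S)` —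
the red walk from `c` reaches a first terminal through a port vertex (`X₁ ∨ X₂`); to reach the other terminal it
either uses a port vertex of the other side or crosses a red bridge (`conn_ab_imp_bridge`: along a red walk from `a`
every vertex is `a`, or red-bare-connected to a red neighbour of `a`, or the bridge is already found).  Hence the
general converse dictionary **`rcSrc_iff_gen`**: `IsRcSrc O S ↔ Adm x ∧ ValidY (RedBridge O S) x ∧ RcOutside O S`
(`ValidY Y x := (X₁ x ∨ X₂ x) ∧ (X₁ x ∧ X₂ x ∨ Y)`, which is `V_∨` when `Y` holds and `V_∧` otherwise) — no edge
between the terminals assumed.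
-/

namespace PercRepro

namespace MultiGraph

open Finset ZonePort

variable {V E : Type*} {G : MultiGraph V E}

section Bridge

variable [Fintype V] {a b c : V} (hca : c ≠ a) (hcb : c ≠ b)
  (hc : ∀ e, ¬ G.Joins e c a ∧ ¬ G.Joins e c b) (hne : a ≠ b) (O : Config E) {S : Config E}

/-- A red bridge between the terminals outside `K`: a red edge between them, or a vertex outside `K` with a red
edge to `a` red-bare-connected to a vertex with a red edge to `b`. -/
def RedBridge (G : MultiGraph V E) (a b c : V) (O S : Config E) : Prop :=
  (∃ e, G.Joins e a b ∧ S e = true) ∨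
    ∃ u w, u ∉ G.BareReach a b c O ∧ Relation.ReflTransGen (G.BareAdj a b O) u w ∧
      (∃ e, G.Joins e u a ∧ S e = true) ∧ (∃ e, G.Joins e w b ∧ S e = true)

/-- The validity predicate with the bridge flag `Y`: `(X₁ ∨ X₂) ∧ (X₁ ∧ X₂ ∨ Y)`. -/
def ValidY {E' : Type*} (P : ZonePort.Problem V E') (Y : Prop) (x : P.Term → Bool) : Prop :=
  (P.X₁ x ∨ P.X₂ x) ∧ (P.X₁ x ∧ P.X₂ x ∨ Y)

variable {O}

omit [Fintype V] in
/-- Red bare walks reverse. -/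
theorem bareConn_symm {u w : V} (h : Relation.ReflTransGen (G.BareAdj a b O) u w) :
    Relation.ReflTransGen (G.BareAdj a b O) w u := by
  induction h with
  | refl => exact Relation.ReflTransGen.refl
  | tail _ hbc ih => exact Relation.ReflTransGen.head hbc.symm ih

omit [Fintype V] in
/-- A red bare walk from a vertex outside `K` stays outside `K`. -/
theorem not_mem_bareReach_of_bareConn {u w : V} (hu : u ∉ G.BareReach a b c O)
    (h : Relation.ReflTransGen (G.BareAdj a b O) u w) : w ∉ G.BareReach a b c O :=
  fun hw => hu (Relation.ReflTransGen.trans hw (bareConn_symm h))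

omit [Fintype V] in
/-- **Along a red walk from `a`** every vertex is `a`, or a non-terminal red-bare-connected to a red neighbour of
`a`, or a bridge has been crossed. -/
theorem conn_ab_imp_bridge (hagree : G.AgreeBare a b O S) (h : G.Conn S a b) (hne : a ≠ b) :
    (∃ e, G.Joins e a b ∧ S e = true) ∨
      ∃ u w, Relation.ReflTransGen (G.BareAdj a b O) u w ∧
        (∃ e, G.Joins e u a ∧ S e = true) ∧ (∃ e, G.Joins e w b ∧ S e = true) := by
  have key : ∀ v, G.Conn S a v →
      v = a ∨ ((v ≠ a ∧ v ≠ b) ∧ ∃ u, (∃ e, G.Joins e u a ∧ S e = true) ∧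
        Relation.ReflTransGen (G.BareAdj a b O) u v) ∨
      ((∃ e, G.Joins e a b ∧ S e = true) ∨
        ∃ u w, Relation.ReflTransGen (G.BareAdj a b O) u w ∧
          (∃ e, G.Joins e u a ∧ S e = true) ∧ (∃ e, G.Joins e w b ∧ S e = true)) := by
    intro v hv
    unfold Conn at hv
    induction hv with
    | refl => exact Or.inl rfl
    | @tail z v _ hzv ih =>
      obtain ⟨e, hSe, hj⟩ := hzv
      have hjoin : G.Joins e z v := hj
      rcases ih with hza | ⟨⟨hz, u, hu, huz⟩ | hbr⟩
      · -- the step leaves `a`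
        rw [hza] at hjoin
        by_cases hva : v = a
        · exact Or.inl hva
        by_cases hvb : v = b
        · exact Or.inr (Or.inr (Or.inl ⟨e, hvb ▸ hjoin, hSe⟩))
        · exact Or.inr (Or.inl ⟨⟨hva, hvb⟩, v, ⟨e, hjoin.symm, hSe⟩, Relation.ReflTransGen.refl⟩)
      · by_cases hva : v = a
        · exact Or.inl hva
        by_cases hvb : v = b
        · -- the bridge is crossed
          exact Or.inr (Or.inr (Or.inr ⟨u, z, huz, hu, e, hvb ▸ hjoin, hSe⟩))
        · have hbare : G.Bare a b e := by
            refine ⟨?_, ?_⟩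
            · rintro (h1 | h1) <;> rcases hjoin with ⟨h2, h3⟩ | ⟨h2, h3⟩
              · exact hz.1 (h2.symm.trans h1)
              · exact hva (h2.symm.trans h1)
              · exact hva (h3.symm.trans h1)
              · exact hz.1 (h3.symm.trans h1)
            · rintro (h1 | h1) <;> rcases hjoin with ⟨h2, h3⟩ | ⟨h2, h3⟩
              · exact hz.2 (h2.symm.trans h1)
              · exact hvb (h2.symm.trans h1)
              · exact hvb (h3.symm.trans h1)
              · exact hz.2 (h3.symm.trans h1)
          have hO : O e = true := by
            rw [← hagree e hbare]
            exact hSe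
          exact Or.inr (Or.inl ⟨⟨hva, hvb⟩, u, hu, huz.tail ⟨e, hbare, hO, hjoin⟩⟩)
      · exact Or.inr (Or.inr hbr)
  rcases key b h with hb | ⟨⟨_, hbb⟩, _⟩ | hbr
  · exact absurd hb.symm hne
  · exact absurd rfl hbb
  · exact hbr

include hca hcb hc hne in
/-- **The general validity dictionary**: `c ~_red a ∧ c ~_red b ↔ (X₁ ∨ X₂) ∧ (X₁ ∧ X₂ ∨ RedBridge O S)`. -/
theorem rc_valid_iff (hagree : G.AgreeBare a b O S) :
    (G.Conn S c a ∧ G.Conn S c b) ↔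
      ValidY (G.rcPort a b c O hca hcb hc) (G.RedBridge a b c O S) (rcPattern hca hcb hc S) := by
  unfold ValidY
  constructor
  · rintro ⟨hcA, hcB⟩
    have hX := rc_X_of_conn hca hcb hc hne hagree (Or.inl hcA)
    refine ⟨hX, ?_⟩
    by_cases hXX : (G.rcPort a b c O hca hcb hc).X₁ (rcPattern hca hcb hc S) ∧
        (G.rcPort a b c O hca hcb hc).X₂ (rcPattern hca hcb hc S)
    · exact Or.inl hXX
    right
    rcases conn_ab_imp_bridge hagree (hcA.symm.trans hcB) hne with hab | ⟨u, w, huw, hu, hw⟩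
    · exact Or.inl hab
    · by_cases huK : u ∈ G.BareReach a b c O
      · -- both ends in `K`: a red 1-edge and a red 2-edge at port vertices
        exfalso
        apply hXX
        have hwK : w ∈ G.BareReach a b c O := Relation.ReflTransGen.trans huK huw
        obtain ⟨e₁, hj₁, hS₁⟩ := hu
        obtain ⟨e₂, hj₂, hS₂⟩ := hw
        have hpu : G.IsPortVert a b c O u := ⟨huK, e₁, Or.inl hj₁⟩
        have hpw : G.IsPortVert a b c O w := ⟨hwK, e₂, Or.inr hj₂⟩
        have htu : G.tvOf a b e₁ = u := tvOf_eq_of_portVert a b c O hca hcb hpu (Or.inl hj₁)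
        have htw : G.tvOf a b e₂ = w := tvOf_eq_of_portVert a b c O hca hcb hpw (Or.inr hj₂)
        refine ⟨⟨toTerm hca hcb hc ⟨e₁, u, hpu, Or.inl hj₁⟩, ?_, hS₁⟩,
          ⟨toTerm hca hcb hc ⟨e₂, w, hpw, Or.inr hj₂⟩, ?_, hS₂⟩⟩
        · rw [ts_false_iff hca hcb hc hne]
          show G.Joins e₁ (G.tvOf a b e₁) a
          rw [htu]
          exact hj₁
        · rw [ts_true_iff hca hcb hc hne]
          show G.Joins e₂ (G.tvOf a b e₂) b
          rw [htw]
          exact hj₂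
      · exact Or.inr ⟨u, w, huK, huw, hu, hw⟩
  · rintro ⟨hX, hXX | hbr⟩
    · exact ⟨rc_conn_of_X₁ hca hcb hc hne hagree hXX.1, rc_conn_of_X₂ hca hcb hc hne hagree hXX.2⟩
    · -- one side from a port vertex, the other across the bridge
      have hab : G.Conn S a b := by
        rcases hbr with ⟨e, hj, hS⟩ | ⟨u, w, _, huw, ⟨e₁, hj₁, hS₁⟩, ⟨e₂, hj₂, hS₂⟩⟩
        · exact Conn.of_openAdj ⟨e, hS, hj⟩
        · have huw' : G.Conn S u w := by
            refine reflTransGen_mono' (fun p q h => ?_) huw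
            have h' : G.BareAdj a b S p q := by
              rw [← rc_bareAdj_O_eq hagree]
              exact h
            exact h'.openAdj
          exact ((Conn.of_openAdj ⟨e₁, hS₁, hj₁.symm⟩).trans huw').trans (Conn.of_openAdj ⟨e₂, hS₂, hj₂⟩)
      rcases hX with hX | hX
      · have := rc_conn_of_X₁ hca hcb hc hne hagree hX
        exact ⟨this, this.trans hab⟩
      · have := rc_conn_of_X₂ hca hcb hc hne hagree hX
        exact ⟨this.trans hab.symm, this⟩

include hca hcb hne in
/-- The red bridge reads only the non-port edges. -/
theorem redBridge_rcRecolour (x' : (G.rcPort a b c O hca hcb hc).Term → Bool) (S : Config E) :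
    G.RedBridge a b c O (rcRecolour hca hcb hc O x' S) ↔ G.RedBridge a b c O S := by
  have hab : ∀ e, G.Joins e a b → rcRecolour hca hcb hc O x' S e = S e :=
    fun e he => rcRecolour_of_not_term hca hcb hc _ _ (not_termEdge_of_joins_ab hca hcb O he)
  unfold RedBridge
  constructor
  · rintro (⟨e, hj, hS⟩ | ⟨u, w, huK, huw, ⟨e₁, hj₁, hS₁⟩, ⟨e₂, hj₂, hS₂⟩⟩)
    · exact Or.inl ⟨e, hj, (hab e hj) ▸ hS⟩
    · have hwK := not_mem_bareReach_of_bareConn huK huw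
      rw [rcRecolour_of_not_term hca hcb hc _ _ (not_termEdge_of_not_mem hca hcb hne O huK (Or.inl hj₁))] at hS₁
      rw [rcRecolour_of_not_term hca hcb hc _ _ (not_termEdge_of_not_mem hca hcb hne O hwK (Or.inr hj₂))] at hS₂
      exact Or.inr ⟨u, w, huK, huw, ⟨e₁, hj₁, hS₁⟩, ⟨e₂, hj₂, hS₂⟩⟩
  · rintro (⟨e, hj, hS⟩ | ⟨u, w, huK, huw, ⟨e₁, hj₁, hS₁⟩, ⟨e₂, hj₂, hS₂⟩⟩)
    · exact Or.inl ⟨e, hj, (hab e hj).symm ▸ hS⟩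
    · have hwK := not_mem_bareReach_of_bareConn huK huw
      refine Or.inr ⟨u, w, huK, huw, ⟨e₁, hj₁, ?_⟩, ⟨e₂, hj₂, ?_⟩⟩
      · rw [rcRecolour_of_not_term hca hcb hc _ _ (not_termEdge_of_not_mem hca hcb hne O huK (Or.inl hj₁))]
        exact hS₁
      · rw [rcRecolour_of_not_term hca hcb hc _ _ (not_termEdge_of_not_mem hca hcb hne O hwK (Or.inr hj₂))]
        exact hS₂

include hca hcb hc hne in
/-- **The general converse dictionary**: `IsRcSrc O S ↔ Adm x ∧ ValidY (RedBridge O S) x ∧ RcOutside O S` — no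
edge between the terminals assumed. -/
theorem rcSrc_iff_gen {S : Config E} :
    G.IsRcSrc a b c O S ↔
      ((G.rcPort a b c O hca hcb hc).Adm (rcPattern hca hcb hc S) ∧
        ValidY (G.rcPort a b c O hca hcb hc) (G.RedBridge a b c O S) (rcPattern hca hcb hc S)) ∧
        G.RcOutside a b c O S := by
  constructor
  · intro hS
    obtain ⟨hagree, hrc, hred, hca', hcb', hab'⟩ := hS
    refine ⟨⟨rc_adm hca hcb hc hne hagree hrc (noDoubleZone_of_not_conn hagree hab') (rc_c_not_mem_cluster_a hca')
      (rc_c_not_mem_cluster_b hcb'), (rc_valid_iff hca hcb hc hne hagree).1 hred⟩,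
      outside_of_rcSrc ⟨hagree, hrc, hred, hca', hcb', hab'⟩⟩
  · rintro ⟨⟨hadm, hval⟩, hout⟩
    have hnd := noDoubleZone_of_adm hca hcb hc hne hadm hout
    obtain ⟨hagree, hab, hsw, _⟩ := hout
    have hswitch : ∀ u, (G.BlueTo a S u ∨ G.BlueTo b S u) → G.Switchable a b c O u := by
      intro u hu
      by_cases huK : u ∈ G.BareReach a b c O
      · exact switchable_of_adm_blue hca hcb hc hadm huK hu
      · exact hsw u huK hu
    refine ⟨hagree, fun u hu => (hswitch u hu).1, (rc_valid_iff hca hcb hc hne hagree).2 hval, ?_, ?_, ?_⟩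
    · intro h
      rcases rc_cluster_compl_a_subset hagree hab hnd ((G.mem_cluster).2 h.symm) with h' | ⟨u, hu, huc⟩
      · exact hca h'
      · exact (hswitch u (Or.inl hu)).2 huc.symm
    · intro h
      rcases rc_cluster_compl_b_subset hagree hab hnd ((G.mem_cluster).2 h.symm) with h' | ⟨u, hu, huc⟩
      · exact hcb h'
      · exact (hswitch u (Or.inr hu)).2 huc.symm
    · intro h
      exact rc_b_not_mem_cluster_compl_a hagree hab hnd hne ((G.mem_cluster).2 h)

include hca hcb hc hne in
/-- **Recolouring a source by an admissible pattern valid for its bridge flag gives a source** (general form). -/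
theorem rcSrc_rcRecolour_gen {S : Config E} (hS : G.IsRcSrc a b c O S)
    {x' : (G.rcPort a b c O hca hcb hc).Term → Bool} (hadm : (G.rcPort a b c O hca hcb hc).Adm x')
    (hval : ValidY (G.rcPort a b c O hca hcb hc) (G.RedBridge a b c O S) x') :
    G.IsRcSrc a b c O (rcRecolour hca hcb hc O x' S) := by
  rw [rcSrc_iff_gen hca hcb hc hne, rcPattern_rcRecolour, outside_rcRecolour hca hcb hc hne,
    redBridge_rcRecolour hca hcb hc hne]
  exact ⟨⟨hadm, hval⟩, ((rcSrc_iff_gen hca hcb hc hne).1 hS).2⟩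

end Bridge

end MultiGraph

end PercRepro
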